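import Literature.AnabelianGeometry.EtaleTheta.Discharge.Sec3Thm37OfInputs
import Literature.AnabelianGeometry.EtaleTheta.Discharge.Sec3Thm37RatStdOfCnst
import HarnessLib

/-!
# [EtTh] Theorem 3.7 (i)–(iv) — END KNIT, second form: the Aut-invariance input `hKfix` replaced by
# interface-genre data (print's own route through `Aut_{D^cnst}(A^cnst)`), proof-only

S. Mochizuki, *The étale theta function and its Frobenioid-theoretic manifestations*, Publ. RIMS **45**
(2009) [EtTh], Thm. 3.7, PDF pp. 79–80, proof p. 306 ll. 14–16 ("since `Π^tp_X` acts trivially on `K^×/O_K^×`")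
[cite: MochizukiEtTh2009, Thm 3.7 p.79].  Sequel of `Discharge/Sec3Thm37OfInputs.lean` (p429227; abc-iut cell,
layer L2, node EtTh:Thm3.7 «END KNIT», abc-iut-L2-lead gen 3 R129; seat abc-iut-w5-d164 gen 3): there the (ii)
second-clause input was the binder `hKfix`; abc-iut-w5-d250's `Sec3Thm37RatStdOfCnst.lean` (p428877) derives
`hKfix` for EVERY monoid type from `P : Prop34Cnst T cnst` (already a binder of the knit), the constant-line
clauses `hLine` / `hInt` of the Def. 3.6 (i) data (proposed successor field of the interface, GAP G-w5d124-2) and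
the finiteness of the automorphism groups of `D^cnst = B(Spec K)⁰` (`hfin`, print: every `Aut(L/K)` finite).
`hInt` is a THEOREM at each constructed datum (`Φ₀^ℝ = Φ₀^rlf ⊆ ∏ ℝ_{≥0}` is cancellative,
`IsPerfFactorial.Rlf.isCancelMul`), so it disappears from the constructed-data residual list.  No definitions;
bookkeeping over proved rows; nothing here bears on [IUTchIII] Cor. 3.12.
-/

namespace Literature.AnabelianGeometry.EtaleTheta

open CategoryTheory Opposite Literature.AlgebraicGeometry.Frobenioids

namespace TemperedFrobenioid

universe u₀ v₀ u₁ v₁ u v w uK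

/-! ### §1 Any monoid type -/

section OfCnst

variable {D₀ : Type u₀} [Category.{v₀} D₀] {V : FrdIMonoidStub.{w}}
  {T : RealifiedDivisorMonoids (D₀ := D₀) V} {D : Type u} [Category.{v} D]
  {IsRational IsStrictlyRational : (Dᵒᵖ ⥤ CommMonCat.{w}) → Prop}
  (C₀ : TemperedFrobenioid T D (treeCatVocab D IsRational IsStrictlyRational))
  {Dcnst : Type u₁} [Category.{v₁} Dcnst] {cnst : D₀ ⥤ Dcnst} (p : ℕ) [Fact p.Prime]

/-- **[EtTh] Theorem 3.7 (i)–(iv) — END KNIT, any monoid type, with `hKfix` replaced by interface-genre data**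
(abc-iut-w5-d250's `thm37_ii_ratStd_treeCatVocab_of_cnst'`, p428877): residual binders
{`hBmon`, `hP34` (`Λ = ℤ` only), `hinj` (`Λ = ℝ` only), `hD`, `hnd`, `hrat`, `P : Prop34Cnst T cnst`, `hLine`, `hInt`,
`hfin` (every `Aut_{D^cnst}(Z)` is a torsion group — print: `D^cnst = B(Spec K)⁰`)}. [cite: MochizukiEtTh2009, Thm 3.7 p.79] -/
theorem thm37_of_inputs_of_cnst (hBmon : IsMonoidOn C₀.ratFnFunctor)
    (hP34 : C₀.monoidType = MonoidType.Z → ∀ A : Dᵒᵖ, ∃ L : PadicFrd.PadicFld.{uK} p, L.IsPadicLocal ∧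
      Nonempty (((T.divΛ (C₀.baseOp A)).comp (Units.coeHom (T.BΛ.obj (C₀.baseOp A)))).ker ≃*
        PadicFrd.unitSubgroup L.K))
    (hinj : C₀.monoidType = MonoidType.R → ∀ A : Dᵒᵖ, Function.Injective (T.divΛ (C₀.baseOp A)))
    (hD : IsOfFSMFFType D) (hnd : IsNonDilatingOn C₀.divisorMonoid)
    (hrat : ∀ X : C₀.category,
      PreFrobenioidData.IsRational
        (PreFrobenioid.biratData (C₀.isFrobenioid_treeCatVocab_of_isMonoidOn hBmon)
          (PreFrobenioid.hasBiratSquares_of_isFrobenioid (C₀.isFrobenioid_treeCatVocab_of_isMonoidOn hBmon)))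
        (S := PreFrobenioidData.ofFunctor C₀.divisorMonoid C₀.toElem) (fun a 𝔭 => PrimarySupp a 𝔭) X)
    (P : T.Prop34Cnst cnst)
    (hLine : ∀ (Y : D₀ᵒᵖ) (g : Algebra.GrothendieckGroup (T.ΦR.obj Y)), g ∈ T.cnstR Y →
      ∃ r : T.ΦR.obj Y, g = Algebra.GrothendieckGroup.of r ∨ g = (Algebra.GrothendieckGroup.of r)⁻¹)
    (hInt : ∀ Y : D₀ᵒᵖ, IsCancelMul (T.ΦR.obj Y))
    (hfin : ∀ (Z : Dcnst) (φ : Aut Z), IsOfFinOrder φ) :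
    ((C₀.monoidType = MonoidType.Z → PreFrobenioid.IsOfUnitProfiniteType C₀.toElem) ∧
      (C₀.monoidType = MonoidType.R → PreFrobenioid.IsOfType (PreFrobenioid.IsUnitTrivial C₀.toElem)) ∧
      PreFrobenioid.IsOfIsotropicType C₀.toElem ∧
      PreFrobenioid.IsOfModelType C₀.toElem (C₀.isFrobenioid_treeCatVocab_of_isMonoidOn hBmon)
        (PreFrobenioid.hasBiratSquares_of_isFrobenioid (C₀.isFrobenioid_treeCatVocab_of_isMonoidOn hBmon)) ∧
      PreFrobenioidData.IsOfBiratFrobeniusNormalizedType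
        (PreFrobenioid.biratData (C₀.isFrobenioid_treeCatVocab_of_isMonoidOn hBmon)
          (PreFrobenioid.hasBiratSquares_of_isFrobenioid (C₀.isFrobenioid_treeCatVocab_of_isMonoidOn hBmon))) ∧
      PreFrobenioid.IsOfType (PreFrobenioid.IsSubQuasiFrobeniusTrivial C₀.toElem) ∧
      ¬ PreFrobenioid.IsOfType (PreFrobenioid.IsGroupLikeObj C₀.toElem)) ∧
    ((ModelFrobenioid.data C₀.divisorMonoid C₀.ratFnFunctor C₀.divBNatTrans).IsOfStandardType ∧
      (PreFrobenioidData.ofFunctor C₀.divisorMonoid C₀.toElem).IsOfRationallyStandardType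
        (PreFrobenioid.rsParams (C₀.isFrobenioid_treeCatVocab_of_isMonoidOn hBmon) fun a 𝔭 => PrimarySupp a 𝔭)) ∧
    ((∀ A : C₀.category, FrobenioidFacade.AutActionFactorsThrough (C₀.base ⋙ cnst) C₀.toElem A) ∧
      (C₀.monoidType = MonoidType.Z ∨ C₀.monoidType = MonoidType.Q →
        ∀ A : C₀.category, FrobenioidFacade.AutActionFaithful (C₀.base ⋙ cnst) C₀.toElem A)) ∧
    C₀.Thm37_iv := by
  obtain ⟨hi, ⟨hii1, -⟩, hiii, hiv⟩ := C₀.thm37_of_inputs p hBmon hP34 hinj hD hnd hrat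
    (fun A f b ξ hb hbξ => C₀.pullGp_cnst_eq_self_of_line_of_cnst P A hLine hInt f (hfin _ _) b ξ hb hbξ) P
  exact ⟨hi, ⟨hii1, C₀.thm37_ii_ratStd_treeCatVocab_of_cnst' hBmon hD hnd hrat P hLine hInt hfin⟩, hiii, hiv⟩

end OfCnst

/-! ### §2 `Λ = ℤ` constructed data -/

section OfCnstZ

variable {D₀ : Type u₀} [Category.{v₀} D₀] {dm : DivisorMonoids.{u₀, v₀, w} D₀}
  {hpf : ∀ Y : D₀ᵒᵖ, IsPerfFactorial (dm.Φ₀.obj Y)} {V : FrdIMonoidStub.{w}} {V₀ : FrdICatStub.{u₀, v₀, w} D₀}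
  {D : Type u} [Category.{v} D] {IsRational IsStrictlyRational : (Dᵒᵖ ⥤ CommMonCat.{w}) → Prop}
  (C₀ : TemperedFrobenioid (RealifiedDivisorMonoids.ofRlfZ dm hpf) D (treeCatVocab D IsRational IsStrictlyRational))
  {Dcnst : Type u₁} [Category.{v₁} Dcnst] {cnst : D₀ ⥤ Dcnst} (p : ℕ) [Fact p.Prime]

/-- **`Λ = ℤ` constructed data, interface-genre residuals only**: {`hBmon`, `hP34`, `hD`, `hnd`, `hrat`, `h34`,
`h₀`, `hLine`, `hfin`} — `hInt` is the theorem `IsPerfFactorial.Rlf.isCancelMul`, `hKfix` is derived (p428877),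
`P` is `Prop34Cnst.ofRlfZ h34 h₀` (p418261). [cite: MochizukiEtTh2009, Thm 3.7 p.79] -/
theorem thm37_ofRlfZ_of_inputs_of_cnst (hBmon : IsMonoidOn C₀.ratFnFunctor)
    (hP34 : ∀ A : Dᵒᵖ, ∃ L : PadicFrd.PadicFld.{uK} p, L.IsPadicLocal ∧
      Nonempty ((((RealifiedDivisorMonoids.ofRlfZ dm hpf).divΛ (C₀.baseOp A)).comp
        (Units.coeHom ((RealifiedDivisorMonoids.ofRlfZ dm hpf).BΛ.obj (C₀.baseOp A)))).ker ≃*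
        PadicFrd.unitSubgroup L.K))
    (hD : IsOfFSMFFType D) (hnd : IsNonDilatingOn C₀.divisorMonoid)
    (hrat : ∀ X : C₀.category,
      PreFrobenioidData.IsRational
        (PreFrobenioid.biratData (C₀.isFrobenioid_treeCatVocab_of_isMonoidOn hBmon)
          (PreFrobenioid.hasBiratSquares_of_isFrobenioid (C₀.isFrobenioid_treeCatVocab_of_isMonoidOn hBmon)))
        (S := PreFrobenioidData.ofFunctor C₀.divisorMonoid C₀.toElem) (fun a 𝔭 => PrimarySupp a 𝔭) X)
    (h34 : dm.Prop34 V V₀) (h₀ : dm.Prop34Cnst₀ cnst)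
    (hLine : ∀ (Y : D₀ᵒᵖ) (g : Algebra.GrothendieckGroup ((RealifiedDivisorMonoids.ofRlfZ dm hpf).ΦR.obj Y)),
      g ∈ (RealifiedDivisorMonoids.ofRlfZ dm hpf).cnstR Y →
        ∃ r : (RealifiedDivisorMonoids.ofRlfZ dm hpf).ΦR.obj Y,
          g = Algebra.GrothendieckGroup.of r ∨ g = (Algebra.GrothendieckGroup.of r)⁻¹)
    (hfin : ∀ (Z : Dcnst) (φ : Aut Z), IsOfFinOrder φ) :
    (PreFrobenioid.IsOfUnitProfiniteType C₀.toElem ∧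
      PreFrobenioid.IsOfIsotropicType C₀.toElem ∧
      PreFrobenioid.IsOfModelType C₀.toElem (C₀.isFrobenioid_treeCatVocab_of_isMonoidOn hBmon)
        (PreFrobenioid.hasBiratSquares_of_isFrobenioid (C₀.isFrobenioid_treeCatVocab_of_isMonoidOn hBmon)) ∧
      PreFrobenioidData.IsOfBiratFrobeniusNormalizedType
        (PreFrobenioid.biratData (C₀.isFrobenioid_treeCatVocab_of_isMonoidOn hBmon)
          (PreFrobenioid.hasBiratSquares_of_isFrobenioid (C₀.isFrobenioid_treeCatVocab_of_isMonoidOn hBmon))) ∧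
      PreFrobenioid.IsOfType (PreFrobenioid.IsSubQuasiFrobeniusTrivial C₀.toElem) ∧
      ¬ PreFrobenioid.IsOfType (PreFrobenioid.IsGroupLikeObj C₀.toElem)) ∧
    ((ModelFrobenioid.data C₀.divisorMonoid C₀.ratFnFunctor C₀.divBNatTrans).IsOfStandardType ∧
      (PreFrobenioidData.ofFunctor C₀.divisorMonoid C₀.toElem).IsOfRationallyStandardType
        (PreFrobenioid.rsParams (C₀.isFrobenioid_treeCatVocab_of_isMonoidOn hBmon) fun a 𝔭 => PrimarySupp a 𝔭)) ∧
    ((∀ A : C₀.category,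
        FrobenioidFacade.AutActionFactorsThrough (C₀.base ⋙ cnst) C₀.toElem A) ∧
      (∀ A : C₀.category, FrobenioidFacade.AutActionFaithful (C₀.base ⋙ cnst) C₀.toElem A)) ∧
    C₀.Thm37_iv := by
  have hZ : C₀.monoidType = MonoidType.Z := rfl
  obtain ⟨⟨hi1, -, hi3, hi4, hi5, hi6, hi7⟩, hii, ⟨hiii1, hiii2⟩, hiv⟩ :=
    C₀.thm37_of_inputs_of_cnst p hBmon (fun _ => hP34) (fun hR => absurd (hZ.symm.trans hR) (by decide)) hD hnd
      hrat (RealifiedDivisorMonoids.Prop34Cnst.ofRlfZ h34 h₀) hLine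
      (fun Y => IsPerfFactorial.Rlf.isCancelMul (hpf Y)) hfin
  exact ⟨⟨hi1 hZ, hi3, hi4, hi5, hi6, hi7⟩, hii, ⟨hiii1, hiii2 (Or.inl hZ)⟩, hiv⟩

end OfCnstZ

end TemperedFrobenioid

end Literature.AnabelianGeometry.EtaleTheta
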